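import Literature.NumberTheory.Transcendental.HolonomyBoundBox
import Literature.NumberTheory.Transcendental.HolonomyBoundBasic
import Literature.NumberTheory.Transcendental.HolonomyBoundCharacteristic
import Mathlib.RingTheory.PowerSeries.Substitution
import Mathlib.Algebra.Polynomial.AlgebraMap
import Mathlib.Tactic
import HarnessLib

/-!
# The Kummer-twisted arithmetic holonomy bound (Calegari–Dimitrov–Tang 2021, Theorem 3, `p = xᴺ`)

F. Calegari, V. Dimitrov, Y. Tang, *The unbounded denominators conjecture*, J. Amer. Math. Soc.
**38** (2025), 627–702 (arXiv:2109.09040), §2, Theorem 3 (Theorem 2.0.1 of the published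
numbering; "the arithmetic holonomicity theorem"), is the algebraization engine of the proof of
the unbounded denominators conjecture (used through Corollary 5 in Proposition 15): for a rational
function `p`, a formal substitution `x(t) ∈ t + t²ℚ⟦t⟧` with `p(x(t)) ∈ ℤ⟦t⟧`, a holomorphic
`φ : 𝔻̄ → ℂ` with `φ(0) = 0`, `|φ'(0)| > 1`, and `ℚ(p(x))`-linearly independent
`f₁,…,f_m ∈ ℚ⟦x⟧` with `x^*fᵢ ∈ ℤ⟦t⟧` and `φ^*fᵢ` holomorphic on `𝔻̄`,
`m ≤ e · ∫_𝕋 log⁺|p ∘ φ| μ_Haar / log|φ'(0)|`.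

This file PROVES that bound for the case used in the proof of Theorem 1, `p(x) = xᴺ`
(Proposition 15: `x = (λ/16)^{1/N}`, `p(x) = xᴺ ∈ ℤ⟦q⟧`), with the constant `e` improved to `2`
and in division-free form:

> `m · log|φ'(0)| ≤ 2 · ⨍_𝕋 log⁺|φᴺ| = 2N · ⨍_𝕋 log⁺|φ|`  (`holonomyBound_twisted`).

The proof is NOT the one printed in CDT 2021 (Siegel's lemma in `d → ∞` auxiliary variables,
Cauchy on the torus `𝕋ᵈ`, Nevanlinna's canonical factorisation, Stirling) but runs the
*dynamic box principle* of the same authors' 2024 paper (arXiv:2408.15403, Appendix §17, after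
Perelli–Zannier), which the tree proves in `HolonomyBound{Counting,Jumps,Germs,Estimate,Den,Box,
Basic,Meromorphic,Nevanlinna,Characteristic}.lean` (the "basic basic" bound
`m (log|φ'(0)| − Σ bⱼ) ≤ 2 ⨍ log⁺|φ|` for `ℚ(x)`-independent functions of a denominator type),
with two changes:

* **integrality of lowest coefficients only.** The Kummer twist `x(t)` destroys the integrality
  of the `x`-coefficients of the `fᵢ` but keeps that of the LOWEST non-zero coefficient of every
  integer combination `F = Σ c(i,k) x^{Nk} fᵢ` (it is the lowest coefficient of
  `F(x(t)) ∈ ℤ⟦t⟧`; CDT's Liouville lower bound (LLB)). The box count of App. §17.2 only ever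
  uses differences of two outputs sharing a prefix, which are such lowest coefficients, so it
  goes through: `box_inequality_of_lowest_coeff_int` (for ANY finite independent family) and the
  endgame `holonomyBound_of_lowest_coeff_int`.
* **the monomials `p(x)ᵏ = x^{Nk}`.** The combination is a `combo` of the tree with coefficients
  reindexed to degree `< N D` (`sum_smul_X_pow_mul_eq_combo`), so the tree's Cauchy estimates
  apply with `M^{N D} = (Mᴺ)ᴰ`, which produces the factor `N` = `deg p` of the growth term.

Contents (theorems only; no definition, no named fact): `card_le_of_sub_int_of_diam_le`,
`box_inequality_of_lowest_coeff_int`, `holonomyBound_of_lowest_coeff_int`,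
`sum_smul_X_pow_mul_eq_combo`, `holonomyBound_twisted_sup` (CDT 2021 Theorem 6 with `h = 1`,
`p = xᴺ`, constant `2`), `holonomyBound_twisted_meromorphic`, `holonomyBound_twisted` (CDT 2021
Theorem 3, `p = xᴺ`, constant `2`, integrality in the abstract form of (LLB)),
`coeff_subst_of_forall_lt` + `lowest_coeff_int_of_subst` ((LLB): substituting
`x(t) ∈ t + t²ℚ⟦t⟧` keeps the lowest coefficient; hence (ii) of loc. cit. gives the abstract
integrality) and `holonomyBound_twisted_of_subst` (Theorem 3, `p = xᴺ`, with (ii) as printed: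
`x(t)ᴺ, fᵢ(x(t)) ∈ ℤ⟦t⟧`, via Mathlib's `PowerSeries.subst`); `holonomyBound_twisted_div`
(quotient form), `card_le_of_radius_of_meanGrowth` (the arithmetic of Proposition 15: radius
`log|φ'(0)| ≥ c/N³` and mean growth `≤ C₁ log N/N` give `m ≤ (2C₁/c) N³ log N`) and
`linearIndependent_X_pow_mul_of_forall_aeval` (`ℚ[xᴺ]`-independence as in CDT ⇒ `hindep`).
Written
for the `provefact` unit of `CalegariDimitrovTang2025_unboundedDenominators`
(`Literature/NumberTheory/Automorphic/UnboundedDenominators*.lean`).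

## References

* [CalegariDimitrovTang2025] F. Calegari, V. Dimitrov, Y. Tang, The unbounded denominators
  conjecture, J. Amer. Math. Soc. 38 (2025), 627–702; arXiv:2109.09040, §2 Theorem 3, Theorem 6,
  Lemma 7, §2.2; §3 Proposition 15.
* [CalegariDimitrovTang2024] F. Calegari, V. Dimitrov, Y. Tang, The linear independence of `1`,
  `ζ(2)` and `L(2, χ₋₃)`, arXiv:2408.15403, Appendix §17 (pp. 129–130).
-/

noncomputable section

open Filter Metric Finset PowerSeries MeromorphicAt MeasureTheory MeromorphicOn Real Set Topology
open scoped Topology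

namespace Literature.NumberTheory.Transcendental

namespace HolonomyBound

/-! ### The box inequality for an arbitrary independent family, integrality of lowest
coefficients only -/

/-- Rationals with pairwise INTEGER differences and diameter `≤ A` are at most `2A + 1` in
number (translate of a set of integers in an interval). [folklore] -/
theorem card_le_of_sub_int_of_diam_le (S : Finset ℚ) {A : ℝ} (hA : 0 ≤ A)
    (hsub : ∀ β ∈ S, ∀ β' ∈ S, ∃ z : ℤ, (β : ℚ) - β' = z)
    (hdiam : ∀ β ∈ S, ∀ β' ∈ S, |((β : ℚ) : ℝ) - β'| ≤ A) :
    (S.card : ℝ) ≤ 2 * A + 1 := by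
  classical
  rcases S.eq_empty_or_nonempty with rfl | ⟨β₀, hβ₀⟩
  · simp only [Finset.card_empty, Nat.cast_zero]
    positivity
  set S' : Finset ℚ := S.image fun β => β - β₀ with hS'
  have hcard : S'.card = S.card := Finset.card_image_of_injective _ (sub_left_injective)
  have h := card_le_of_den_dvd_of_diam_le S' Nat.one_pos hA ?_ ?_
  · rw [hcard, Nat.cast_one, mul_one] at h
    exact h
  · intro β hβ
    obtain ⟨γ, hγ, rfl⟩ := Finset.mem_image.mp hβ
    obtain ⟨z, hz⟩ := hsub γ hγ β₀ hβ₀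
    exact ⟨z, by rw [hz, Nat.cast_one, div_one]⟩
  · intro β hβ β' hβ'
    obtain ⟨γ, hγ, rfl⟩ := Finset.mem_image.mp hβ
    obtain ⟨γ', hγ', rfl⟩ := Finset.mem_image.mp hβ'
    have := hdiam γ hγ γ' hγ'
    push_cast
    rwa [show ((γ : ℝ) - β₀) - (γ' - β₀) = γ - γ' by ring]

variable {ι : Type*} [Fintype ι] [DecidableEq ι]

/-- **The box inequality of the dynamic box principle, for an arbitrary finite independent
family and with integrality only of lowest coefficients** (Calegari–Dimitrov–Tang 2024,
Appendix §17, §§17.1–17.2, as in `box_inequality`, but: the generating family `v : ι → ℚ⟦X⟧` is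
any `ℚ`-linearly independent finite family; instead of a denominator type we assume that every
INTEGER combination `Σ cᵢ vᵢ` has an integral lowest non-zero coefficient — which is what the
Kummer-twisted integrality `x^* fᵢ ∈ ℤ⟦t⟧`, `x(t) ∈ t + t²ℚ⟦t⟧`, of Calegari–Dimitrov–Tang
2021, Theorem 2.0.1 (ii), supplies — and the analytic input is the abstract bound
`|β| ρⁿ ≤ K` for the lowest coefficient `β` (at `Xⁿ`) of rational combinations with
`|cᵢ| ≤ T`). Then `T^{#ι} ≤ Π_p (2K/ρ^{u p} + 1)` for the jumps `u`. The point, as in CDT's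
tree count: two box outputs sharing a prefix differ by a combination vanishing below the jump
`u(p)`, whose `u(p)`-th coefficient is a lowest coefficient — an integer of size `≤ K/ρ^{u p}`.
[cite: CalegariDimitrovTang2024, Appendix §17.2–17.3 (p. 130)]
[cite: CalegariDimitrovTang2025, §2, proof of Theorem 6 (Liouville lower bound (LLB))] -/
theorem box_inequality_of_lowest_coeff_int (v : ι → PowerSeries ℚ)
    (hindep : LinearIndependent ℚ v)
    (hint : ∀ c : ι → ℤ, ∀ n : ℕ, (∀ k < n, coeff k (∑ i, (c i : ℚ) • v i) = 0) →
      ∃ z : ℤ, coeff n (∑ i, (c i : ℚ) • v i) = z)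
    {ρ K : ℝ} (hρ : 0 < ρ) (hK : 0 ≤ K) {T : ℕ}
    (hbound : ∀ c : ι → ℚ, (∀ i, |(c i : ℝ)| ≤ T) →
      ∀ n, (∀ k < n, coeff k (∑ i, c i • v i) = 0) →
        |((coeff n (∑ i, c i • v i) : ℚ) : ℝ)| * ρ ^ n ≤ K)
    {u : Fin (Fintype.card ι) → ℕ} (hu : StrictMono u)
    (hu_all : ∀ w ∈ Submodule.span ℚ (Set.range v), w ≠ 0 → ∃ p, w.order = u p) :
    (T : ℝ) ^ Fintype.card ι ≤ ∏ p, (2 * (K / ρ ^ (u p)) + 1) := by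
  classical
  -- the evaluation map on the box and the tree map
  let ψ : (ι → Fin T) → PowerSeries ℚ := fun c => ∑ i, ((c i : ℕ) : ℚ) • v i
  let Φ : (ι → Fin T) → (Fin (Fintype.card ι) → ℚ) := fun c p => coeff (u p) (ψ c)
  have hdiff : ∀ c₁ c₂ : ι → Fin T,
      ψ c₁ - ψ c₂ = ∑ i, (((c₁ i : ℕ) : ℚ) - ((c₂ i : ℕ) : ℚ)) • v i := by
    intro c₁ c₂
    simp only [ψ, sub_smul, Finset.sum_sub_distrib]
  have hdiffZ : ∀ c₁ c₂ : ι → Fin T,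
      ψ c₁ - ψ c₂ = ∑ i, ((((c₁ i : ℕ) : ℤ) - ((c₂ i : ℕ) : ℤ) : ℤ) : ℚ) • v i := by
    intro c₁ c₂
    rw [hdiff]
    push_cast
    rfl
  have hspan : ∀ c : ι → ℚ, ∑ i, c i • v i ∈ Submodule.span ℚ (Set.range v) := fun c =>
    Submodule.sum_mem _ fun i _ => Submodule.smul_mem _ _ (Submodule.subset_span ⟨i, rfl⟩)
  have hψinj : ∀ c₁ c₂ : ι → Fin T, ψ c₁ = ψ c₂ → c₁ = c₂ := by
    intro c₁ c₂ h
    have h0 : ∑ i, (((c₁ i : ℕ) : ℚ) - ((c₂ i : ℕ) : ℚ)) • v i = 0 := by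
      rw [← hdiff, h, sub_self]
    have := Fintype.linearIndependent_iff.mp hindep _ h0
    funext i
    have hi := this i
    rw [sub_eq_zero] at hi
    exact Fin.ext (by exact_mod_cast hi)
  have hΦinj : Function.Injective Φ := by
    intro c₁ c₂ h
    by_contra hne
    have hne' : ψ c₁ ≠ ψ c₂ := fun h' => hne (hψinj c₁ c₂ h')
    have hw0 : ψ c₁ - ψ c₂ ≠ 0 := sub_ne_zero.mpr hne'
    have hwspan : ψ c₁ - ψ c₂ ∈ Submodule.span ℚ (Set.range v) := by
      rw [hdiff]; exact hspan _
    obtain ⟨p₀, hp₀⟩ := hu_all _ hwspan hw0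
    have hcoeff : coeff (u p₀) (ψ c₁ - ψ c₂) ≠ 0 := by
      have h1 := coeff_order hw0
      have h2 : (ψ c₁ - ψ c₂).order.toNat = u p₀ := by
        rw [← ENat.coe_inj, coe_toNat_order hw0, hp₀]
      rwa [h2] at h1
    apply hcoeff
    rw [map_sub]
    have := congr_fun h p₀
    simp only [Φ] at this
    rw [this, sub_self]
  -- the finite set of coefficient strings and its cardinality
  set S : Finset (Fin (Fintype.card ι) → ℚ) := Finset.univ.image Φ with hS
  have hScard : S.card = T ^ Fintype.card ι := by
    rw [hS, Finset.card_image_of_injective _ hΦinj, Finset.card_univ, Fintype.card_fun,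
      Fintype.card_fin]
  -- the branching bound at level `p`
  set A : Fin (Fintype.card ι) → ℝ := fun p => K / ρ ^ (u p) with hA
  have hA0 : ∀ p, 0 ≤ A p := fun p => by simp only [hA]; positivity
  have hbranch : ∀ (p : Fin (Fintype.card ι)) (s : Fin (Fintype.card ι) → ℚ), s ∈ S →
      ((((samePrefix S s p).image fun t => t p).card : ℕ) : ℝ) ≤ 2 * A p + 1 := by
    intro p s hs
    set Y : Finset ℚ := (samePrefix S s p).image fun t => t p with hY
    have hYmem : ∀ y ∈ Y, ∃ c : ι → Fin T, Φ c ∈ samePrefix S s p ∧ y = coeff (u p) (ψ c) := by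
      intro y hy
      obtain ⟨t, ht, rfl⟩ := Finset.mem_image.mp hy
      obtain ⟨htS, -⟩ := mem_samePrefix.mp ht
      obtain ⟨c, -, rfl⟩ := Finset.mem_image.mp htS
      exact ⟨c, ht, rfl⟩
    -- two members with the same prefix differ by a combination vanishing below `u p`
    have hlow : ∀ c₁ c₂ : ι → Fin T, Φ c₁ ∈ samePrefix S s p → Φ c₂ ∈ samePrefix S s p →
        ∀ k < u p, coeff k (ψ c₁ - ψ c₂) = 0 := by
      intro c₁ c₂ hc₁ hc₂
      set w : PowerSeries ℚ := ψ c₁ - ψ c₂ with hw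
      by_cases hw0 : w = 0
      · intro k _; rw [hw0, map_zero]
      · have hwspan : w ∈ Submodule.span ℚ (Set.range v) := by
          rw [hw, hdiff]; exact hspan _
        obtain ⟨p₁, hp₁⟩ := hu_all w hwspan hw0
        have hpp₁ : p ≤ p₁ := by
          by_contra hlt
          push Not at hlt
          have hc := coeff_order hw0
          have h2 : w.order.toNat = u p₁ := by
            rw [← ENat.coe_inj, coe_toNat_order hw0, hp₁]
          rw [h2] at hc
          apply hc
          obtain ⟨-, hpre₁⟩ := mem_samePrefix.mp hc₁
          obtain ⟨-, hpre₂⟩ := mem_samePrefix.mp hc₂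
          rw [hw, map_sub]
          have e1 : coeff (u p₁) (ψ c₁) = s p₁ := hpre₁ p₁ hlt
          have e2 : coeff (u p₁) (ψ c₂) = s p₁ := hpre₂ p₁ hlt
          rw [e1, e2, sub_self]
        intro k hk
        apply coeff_of_lt_order
        rw [hp₁]
        exact_mod_cast lt_of_lt_of_le hk (hu.monotone hpp₁)
    refine card_le_of_sub_int_of_diam_le Y (hA0 p) ?_ ?_
    · -- integrality of differences
      intro y₁ hy₁ y₂ hy₂
      obtain ⟨c₁, hc₁, rfl⟩ := hYmem y₁ hy₁
      obtain ⟨c₂, hc₂, rfl⟩ := hYmem y₂ hy₂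
      have hl := hlow c₁ c₂ hc₁ hc₂
      rw [hdiffZ] at hl
      obtain ⟨z, hz⟩ := hint _ (u p) hl
      refine ⟨z, ?_⟩
      rw [← hz, ← hdiffZ, map_sub]
    · -- diameter
      intro y₁ hy₁ y₂ hy₂
      obtain ⟨c₁, hc₁, rfl⟩ := hYmem y₁ hy₁
      obtain ⟨c₂, hc₂, rfl⟩ := hYmem y₂ hy₂
      have hTbd : ∀ i, |((((c₁ i : ℕ) : ℚ) - ((c₂ i : ℕ) : ℚ) : ℚ) : ℝ)| ≤ T := by
        intro i
        have h1 : ((c₁ i : ℕ) : ℝ) < T := by exact_mod_cast (c₁ i).isLt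
        have h2 : ((c₂ i : ℕ) : ℝ) < T := by exact_mod_cast (c₂ i).isLt
        have h3 : (0 : ℝ) ≤ ((c₁ i : ℕ) : ℝ) := Nat.cast_nonneg _
        have h4 : (0 : ℝ) ≤ ((c₂ i : ℕ) : ℝ) := Nat.cast_nonneg _
        push_cast
        rw [abs_le]
        constructor <;> linarith
      have hl := hlow c₁ c₂ hc₁ hc₂
      rw [hdiff] at hl
      have hest := hbound _ hTbd (u p) hl
      rw [← hdiff, map_sub, Rat.cast_sub] at hest
      have hρn : 0 < ρ ^ u p := pow_pos hρ _
      rw [hA]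
      simp only
      rw [le_div_iff₀ hρn]
      exact hest
  -- tree counting
  set γ : Fin (Fintype.card ι) → ℕ := fun p => ⌊2 * A p⌋₊ + 1 with hγ
  have hγbd : ∀ (p : Fin (Fintype.card ι)) (s : Fin (Fintype.card ι) → ℚ), s ∈ S →
      ((samePrefix S s p).image fun t => t p).card ≤ γ p := by
    intro p s hs
    have h := hbranch p s hs
    have hx0 : 0 ≤ 2 * A p := by have := hA0 p; positivity
    have h2 : (((samePrefix S s p).image fun t => t p).card : ℝ) < (⌊2 * A p⌋₊ : ℕ) + 2 := by
      have := Nat.lt_floor_add_one (2 * A p)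
      linarith
    have h3 : ((samePrefix S s p).image fun t => t p).card < ⌊2 * A p⌋₊ + 2 := by
      exact_mod_cast h2
    simp only [hγ]
    omega
  have hcount := card_le_prod_of_forall_card_image_le S γ hγbd
  rw [hScard] at hcount
  have hcountR : ((T ^ Fintype.card ι : ℕ) : ℝ) ≤ ∏ p, (γ p : ℝ) := by exact_mod_cast hcount
  push_cast at hcountR
  refine le_trans hcountR (Finset.prod_le_prod (fun p _ => by positivity) fun p _ => ?_)
  simp only [hγ]
  push_cast
  have hx0 : 0 ≤ 2 * A p := by have := hA0 p; positivity
  have := Nat.floor_le hx0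
  simp only [hA] at this ⊢
  linarith

/-! ### The endgame of the dynamic box principle with lowest-coefficient integrality -/

/-- **The dynamic box principle, abstract endgame, for lowest-coefficient integrality**
(the endgame of Calegari–Dimitrov–Tang 2024, Appendix §17, pp. 129–130, run as in
`holonomyBound_of_coeff_bound` but for an arbitrary sequence of generating families
`v D : Fin m × Fin D → ℚ⟦X⟧` (`D = 1, 2, …`), each `ℚ`-linearly independent, whose INTEGER
combinations have integral lowest non-zero coefficients, and the abstract Cauchy-type estimate
`|β| ρⁿ ≤ m·T·D·M^D·G` for the lowest coefficient of rational combinations with `|c| ≤ T`):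
`m · log ρ ≤ 2 · log M`. (No denominator type: `den = 1`, rate `Σ bⱼ = 0`.)
[cite: CalegariDimitrovTang2024, Appendix §17 eqs. (PZ penultimate), (PZ final) (p. 130)]
[cite: CalegariDimitrovTang2025, §2.2 (proof of Theorem 6: (LLB), (CUP))] -/
theorem holonomyBound_of_lowest_coeff_int (m : ℕ) (v : (D : ℕ) → Fin m × Fin D → PowerSeries ℚ)
    (hindep : ∀ D : ℕ, LinearIndependent ℚ (v D))
    (hint : ∀ (D : ℕ) (c : Fin m × Fin D → ℤ) (n : ℕ),
      (∀ k < n, coeff k (∑ i, (c i : ℚ) • v D i) = 0) →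
        ∃ z : ℤ, coeff n (∑ i, (c i : ℚ) • v D i) = z)
    {ρ M G : ℝ} (hρ0 : 0 ≤ ρ) (hM1 : 1 ≤ M)
    (hbound : ∀ (D : ℕ) (T : ℝ), 1 ≤ T → ∀ c : Fin m × Fin D → ℚ, (∀ i, |(c i : ℝ)| ≤ T) →
      ∀ n, (∀ k < n, coeff k (∑ i, c i • v D i) = 0) →
        |((coeff n (∑ i, c i • v D i) : ℚ) : ℝ)| * ρ ^ n ≤ m * T * D * M ^ D * G) :
    (m : ℝ) * Real.log ρ ≤ 2 * Real.log M := by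
  classical
  set θ : ℝ := Real.log ρ with hθdef
  have hlogM : 0 ≤ Real.log M := Real.log_nonneg hM1
  -- trivial cases
  rcases le_or_gt θ 0 with hθ0 | hθpos
  · calc (m : ℝ) * θ ≤ 0 := mul_nonpos_of_nonneg_of_nonpos (Nat.cast_nonneg _) hθ0
      _ ≤ 2 * Real.log M := by positivity
  rcases Nat.eq_zero_or_pos m with rfl | hm
  · simp only [Nat.cast_zero, zero_mul]; positivity
  -- `ρ > 0` (else `θ = log 0 = 0`)
  have hρ : 0 < ρ := by
    by_contra h
    have hρ0' : ρ = 0 := le_antisymm (not_lt.mp h) hρ0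
    rw [hθdef, hρ0', Real.log_zero] at hθpos
    exact lt_irrefl _ hθpos
  have hmR : (0 : ℝ) < m := by exact_mod_cast hm
  -- the bound with `G₁ = max G 1`
  set G₁ : ℝ := max G 1 with hG₁
  have hG₁1 : 1 ≤ G₁ := le_max_right _ _
  have hM0 : 0 ≤ M := zero_le_one.trans hM1
  have hbound₁ : ∀ (D : ℕ) (T : ℝ), 1 ≤ T → ∀ c : Fin m × Fin D → ℚ,
      (∀ i, |(c i : ℝ)| ≤ T) → ∀ n, (∀ k < n, coeff k (∑ i, c i • v D i) = 0) →
        |((coeff n (∑ i, c i • v D i) : ℚ) : ℝ)| * ρ ^ n ≤ m * T * D * M ^ D * G₁ := by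
    intro D T hT c hc n hn
    refine (hbound D T hT c hc n hn).trans ?_
    have h0 : (0 : ℝ) ≤ m * T * D * M ^ D := by
      have : (0 : ℝ) ≤ T := zero_le_one.trans hT
      positivity
    exact mul_le_mul_of_nonneg_left (le_max_left _ _) h0
  set K : ℝ := 2 * m * G₁ with hK
  have hK1 : 1 ≤ K := by
    rw [hK]
    have h1 : (1 : ℝ) ≤ m := by exact_mod_cast hm
    have h2 : (1 : ℝ) ≤ (m : ℝ) * G₁ := one_le_mul_of_one_le_of_one_le h1 hG₁1
    linarith
  have hK0 : 0 < K := by linarith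
  -- the inequality for each `D ≥ 1`: `θ (m D - 1) ≤ 2 log (2 K D) + 2 D log M`
  have hD : ∀ D : ℕ, 1 ≤ D →
      θ * ((m : ℝ) * D - 1) ≤ 2 * Real.log (2 * K * D) + 2 * D * Real.log M := by
    intro D hD1
    have hDR : (1 : ℝ) ≤ D := by exact_mod_cast hD1
    -- the jumps
    obtain ⟨u, hu, -, hu_all⟩ := exists_strictMono_orders (v D) (hindep D)
    have hNmD : Fintype.card (Fin m × Fin D) = m * D := by
      rw [Fintype.card_prod, Fintype.card_fin, Fintype.card_fin]
    have hN1 : 1 ≤ Fintype.card (Fin m × Fin D) := by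
      rw [hNmD]; exact Nat.one_le_iff_ne_zero.mpr (Nat.mul_ne_zero hm.ne' (by omega))
    -- the parameter `T`
    set U : ℕ := Finset.univ.sup u with hU
    have hUp : ∀ p, u p ≤ U := fun p => Finset.le_sup (Finset.mem_univ p)
    set T : ℕ := ⌈Real.exp (θ * U)⌉₊ + 1 with hT
    have hT1 : 1 ≤ T := Nat.le_add_left 1 _
    have hTR : Real.exp (θ * U) ≤ T := by
      rw [hT]; push_cast
      linarith [Nat.le_ceil (Real.exp (θ * U))]
    have hT0 : (0 : ℝ) < T := by exact_mod_cast hT1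
    -- the box inequality
    have hTR1 : (1 : ℝ) ≤ (T : ℝ) := by exact_mod_cast hT1
    have hKD : (0 : ℝ) ≤ m * T * D * M ^ D * G₁ := by
      have : (0 : ℝ) ≤ G₁ := zero_le_one.trans hG₁1
      positivity
    have hbox := box_inequality_of_lowest_coeff_int (v D) (hindep D) (hint D) hρ hKD
      (fun c hc n hn => hbound₁ D T hTR1 c hc n hn) hu hu_all
    -- bound each factor by `2 x_p`, `x_p = K T D M^D exp(-θ u p)`
    set x : Fin (Fintype.card (Fin m × Fin D)) → ℝ :=
      fun p => K * T * D * M ^ D * Real.exp (-(θ * u p)) with hx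
    have hMD : (1 : ℝ) ≤ M ^ D := one_le_pow₀ hM1
    have hx1 : ∀ p, 1 ≤ x p := by
      intro p
      have h1 : (1 : ℝ) ≤ Real.exp (θ * U) * Real.exp (-(θ * u p)) := by
        rw [← Real.exp_add, Real.one_le_exp_iff]
        have : (u p : ℝ) ≤ U := by exact_mod_cast hUp p
        nlinarith
      calc (1 : ℝ) ≤ Real.exp (θ * U) * Real.exp (-(θ * u p)) := h1
        _ = 1 * Real.exp (θ * U) * 1 * 1 * Real.exp (-(θ * u p)) := by ring
        _ ≤ K * T * D * M ^ D * Real.exp (-(θ * u p)) := by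
            gcongr
    have hρu : ∀ n : ℕ, ρ ^ n = Real.exp (n * Real.log ρ) := by
      intro n
      rw [← Real.exp_log (pow_pos hρ n), Real.log_pow]
    have hfac : ∀ p, 2 * ((m : ℝ) * T * D * M ^ D * G₁ / ρ ^ (u p)) + 1 ≤ 2 * x p := by
      intro p
      have hexp : (1 : ℝ) / ρ ^ (u p) = Real.exp (-(θ * u p)) := by
        rw [hρu, one_div, ← Real.exp_neg]
        congr 1
        rw [hθdef]
        ring
      have h1 : 2 * ((m : ℝ) * T * D * M ^ D * G₁ / ρ ^ (u p)) = x p := by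
        calc 2 * ((m : ℝ) * T * D * M ^ D * G₁ / ρ ^ (u p))
            = (2 * m * G₁) * T * D * M ^ D * (1 / ρ ^ (u p)) := by ring
          _ = x p := by rw [hexp, hx, hK]
      linarith [hx1 p]
    -- hence `T^{mD} ≤ (2 K T D M^D)^N exp(-θ Σ u p)`
    set Su : ℝ := ∑ p, (u p : ℝ) with hSu
    have hprod : ∏ p, (2 * ((m : ℝ) * T * D * M ^ D * G₁ / ρ ^ (u p)) + 1) ≤ ∏ p, 2 * x p :=
      Finset.prod_le_prod (fun p _ => by positivity) fun p _ => hfac p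
    have hprod2 : ∏ p, 2 * x p =
        (2 * K * T * D * M ^ D) ^ (Fintype.card (Fin m × Fin D)) * Real.exp (-(θ * Su)) := by
      have hxp : ∀ p, 2 * x p = (2 * K * T * D * M ^ D) * Real.exp (-(θ * u p)) := fun p => by
        simp only [hx]; ring
      simp_rw [hxp]
      rw [Finset.prod_mul_distrib, Finset.prod_const, Finset.card_univ, Fintype.card_fin,
        ← Real.exp_sum, Finset.sum_neg_distrib, ← Finset.mul_sum]
    have h1 : (T : ℝ) ^ (m * D) ≤
        (2 * K * T * D * M ^ D) ^ (Fintype.card (Fin m × Fin D)) * Real.exp (-(θ * Su)) := by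
      rw [← hNmD]
      exact hbox.trans (hprod.trans hprod2.le)
    -- cancel `T^{mD}` and take logarithms: `θ Su ≤ N log (2 K D M^D)`
    have hbase : 0 < 2 * K * D * M ^ D := by positivity
    have hkey : Real.exp (θ * Su) ≤ (2 * K * D * M ^ D) ^ (Fintype.card (Fin m × Fin D)) := by
      rw [hNmD] at h1
      have h2 : (2 * K * T * D * M ^ D) ^ (m * D) =
          (2 * K * D * M ^ D) ^ (m * D) * (T : ℝ) ^ (m * D) := by
        rw [← mul_pow]; ring_nf
      rw [h2, Real.exp_neg] at h1
      have hE : 0 < Real.exp (θ * Su) := Real.exp_pos _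
      have h3 := (le_mul_inv_iff₀ hE).mp h1
      have hTk : (0 : ℝ) < (T : ℝ) ^ (m * D) := by positivity
      rw [hNmD]
      refine le_of_mul_le_mul_left ?_ hTk
      calc (T : ℝ) ^ (m * D) * Real.exp (θ * Su)
          ≤ (2 * K * D * M ^ D) ^ (m * D) * (T : ℝ) ^ (m * D) := h3
        _ = (T : ℝ) ^ (m * D) * (2 * K * D * M ^ D) ^ (m * D) := mul_comm _ _
    have hlog : θ * Su ≤
        (Fintype.card (Fin m × Fin D) : ℕ) * (Real.log (2 * K * D) + D * Real.log M) := by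
      have h2 := (Real.le_log_iff_exp_le (pow_pos hbase _)).mpr hkey
      rw [Real.log_pow, Real.log_mul (by positivity) (by positivity), Real.log_pow] at h2
      exact h2
    -- the Gauss sum and the conclusion for this `D`
    set Nr : ℝ := ((Fintype.card (Fin m × Fin D) : ℕ) : ℝ) with hNr
    have hgauss : Nr * (Nr - 1) / 2 ≤ Su := gauss_sum_le hu
    have hNpos : (0 : ℝ) < Nr := by rw [hNr]; exact_mod_cast hN1
    have h4 : Nr * (θ * (Nr - 1) / 2) ≤ Nr * (Real.log (2 * K * D) + D * Real.log M) := by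
      calc Nr * (θ * (Nr - 1) / 2) = θ * (Nr * (Nr - 1) / 2) := by ring
        _ ≤ θ * Su := mul_le_mul_of_nonneg_left hgauss hθpos.le
        _ ≤ Nr * (Real.log (2 * K * D) + D * Real.log M) := hlog
    have h5 := le_of_mul_le_mul_left h4 hNpos
    have hNR : Nr = m * D := by rw [hNr, hNmD]; push_cast; ring
    rw [hNR] at h5
    linarith
  -- conclude by `D → ∞`
  have hlim : Tendsto (fun D : ℕ => 2 * Real.log M +
      ((2 * Real.log (2 * K) + θ) / D + 2 * (Real.log (D : ℝ) / (D : ℝ)))) atTop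
      (𝓝 (2 * Real.log M)) := by
    have h1 : Tendsto (fun D : ℕ => Real.log (D : ℝ) / (D : ℝ)) atTop (𝓝 0) := by
      have h := Real.tendsto_pow_log_div_mul_add_atTop 1 0 1 one_ne_zero
      simp only [pow_one, one_mul, add_zero] at h
      exact h.comp tendsto_natCast_atTop_atTop
    have h2 : Tendsto (fun D : ℕ => (2 * Real.log (2 * K) + θ) / (D : ℝ)) atTop (𝓝 0) :=
      tendsto_const_div_atTop_nhds_zero_nat _
    have h3 := (h2.add (h1.const_mul 2)).const_add (2 * Real.log M)
    simpa using h3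
  have hev : ∀ᶠ D : ℕ in atTop, (m : ℝ) * θ ≤ 2 * Real.log M +
      ((2 * Real.log (2 * K) + θ) / D + 2 * (Real.log (D : ℝ) / (D : ℝ))) := by
    filter_upwards [eventually_ge_atTop 1] with D hD1
    have h := hD D hD1
    have hD0 : (0 : ℝ) < D := by exact_mod_cast hD1
    have hlog2 : Real.log (2 * K * D) = Real.log (2 * K) + Real.log D :=
      Real.log_mul (by positivity) (by positivity)
    rw [hlog2] at h
    have hsplit : 2 * Real.log M + ((2 * Real.log (2 * K) + θ) / D + 2 * (Real.log (D : ℝ) / D))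
        = 2 * Real.log M + (2 * (Real.log (2 * K) + Real.log D) + θ) / D := by
      field_simp
      ring
    rw [hsplit, ← sub_le_iff_le_add', le_div_iff₀ hD0]
    linarith
  exact ge_of_tendsto hlim hev

variable {m : ℕ}

/-! ### The Kummer-twisted generating family `X^{Nk} fᵢ` as a `combo` -/

/-- Reindexing the coefficients: `c (i, k)` sits at the monomial `X^{N k}`. [folklore] -/
theorem reindex_lt {N D : ℕ} (j : Fin (N * D)) : (j : ℕ) / N < D :=
  Nat.div_lt_of_lt_mul j.isLt

/-- **The twisted family is a `combo`**: `Σ_{i,k<D} c(i,k) • (X^{Nk} fᵢ) = W c'` with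
`c' i j = c(i, j/N)` if `N ∣ j < N D` and `0` otherwise (and `cf i = ` the coefficients of `fᵢ`).
[folklore] -/
theorem sum_smul_X_pow_mul_eq_combo {N : ℕ} (hN : 0 < N) (f : Fin m → PowerSeries ℚ) {D : ℕ}
    (c : Fin m × Fin D → ℚ) :
    (∑ ik : Fin m × Fin D, c ik • ((X : PowerSeries ℚ) ^ (N * (ik.2 : ℕ)) * f ik.1)) =
      combo (fun i k => coeff k (f i))
        (fun i (j : Fin (N * D)) =>
          if N ∣ (j : ℕ) then c (i, ⟨(j : ℕ) / N, reindex_lt j⟩) else 0) := by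
  classical
  have hmk : ∀ i, PowerSeries.mk (fun k => coeff k (f i)) = f i := fun i => by
    ext k; rw [coeff_mk]
  rw [combo, Fintype.sum_prod_type]
  refine Finset.sum_congr rfl fun i _ => ?_
  rw [hmk i]
  -- embed `Fin D ↪ Fin (N * D)`, `k ↦ N k`
  let e : Fin D ↪ Fin (N * D) :=
    ⟨fun k => ⟨N * (k : ℕ), Nat.mul_lt_mul_of_pos_left k.isLt hN⟩, fun k₁ k₂ h => by
      have := congrArg (fun x : Fin (N * D) => (x : ℕ)) h
      exact Fin.ext (Nat.eq_of_mul_eq_mul_left hN this)⟩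
  have he : ∀ k : Fin D, ((e k : Fin (N * D)) : ℕ) = N * (k : ℕ) := fun k => rfl
  symm
  rw [← Finset.sum_subset (Finset.subset_univ (Finset.univ.map e))]
  · rw [Finset.sum_map]
    refine Finset.sum_congr rfl fun k _ => ?_
    have hdvd : N ∣ ((e k : Fin (N * D)) : ℕ) := ⟨k, he k⟩
    have hdiv : ((e k : Fin (N * D)) : ℕ) / N = k := by rw [he, Nat.mul_div_cancel_left _ hN]
    have hfin : (⟨((e k : Fin (N * D)) : ℕ) / N, reindex_lt (e k)⟩ : Fin D) = k := Fin.ext hdiv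
    have hc' : (if N ∣ ((e k : Fin (N * D)) : ℕ) then
        c (i, ⟨((e k : Fin (N * D)) : ℕ) / N, reindex_lt (e k)⟩) else 0) = c (i, k) := by
      rw [if_pos hdvd, hfin]
    rw [hc', he]
  · intro j _ hj
    have hndvd : ¬ N ∣ (j : ℕ) := by
      rintro ⟨k, hk⟩
      apply hj
      have hkD : k < D := by
        have := j.isLt
        rw [hk] at this
        exact Nat.lt_of_mul_lt_mul_left this
      exact Finset.mem_map.mpr ⟨⟨k, hkD⟩, Finset.mem_univ _, Fin.ext (by rw [he, ← hk])⟩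
    simp only [hndvd, if_false, zero_smul]

/-- Bounds transfer to the reindexed coefficients. [folklore] -/
theorem abs_reindex_le {N D : ℕ} (c : Fin m × Fin D → ℚ) {T : ℝ} (hT0 : 0 ≤ T)
    (hc : ∀ ik, |(c ik : ℝ)| ≤ T) (i : Fin m) (j : Fin (N * D)) :
    |(((if N ∣ (j : ℕ) then c (i, ⟨(j : ℕ) / N, reindex_lt j⟩) else 0 : ℚ) : ℚ) : ℝ)| ≤ T := by
  split_ifs
  · exact hc _
  · simpa using hT0

/-- **The Kummer-twisted basic holonomy bound, supremum form** — Calegari–Dimitrov–Tang 2021,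
Theorem 6 (the "meromorphic/intermediate form" of their Theorem 3) for `p(x) = x^N` and
`h = 1`, with the constant `e` improved to `2`: let `f₁,…,f_m ∈ ℚ⟦x⟧` be such that the
family `x^{Nk} fᵢ` (`k < D`) is `ℚ`-linearly independent for every `D` (i.e. the `fᵢ` are
`ℚ(x^N)`-linearly independent) and such that every INTEGER combination
`Σ c(i,k) x^{Nk} fᵢ` has an integral lowest non-zero coefficient (the Kummer-twisted
integrality supplied by `x^* fᵢ ∈ ℤ⟦t⟧`, `x(t)^N ∈ ℤ⟦t⟧`, `x(t) ∈ t + t²ℚ⟦t⟧`: the lowest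
coefficient of `F(x)` is that of `F(x(t)) ∈ ℤ⟦t⟧`, CDT's Liouville lower bound (LLB)); let
`φ` be holomorphic on `|z| < R₀` (`R₀ > 1`) with `φ(0) = 0`, the pullbacks `φ^* fᵢ` extending
to holomorphic `gᵢ` there, `|φ| ≤ M` (`M ≥ 1`) and `|gᵢ| ≤ G` on the unit circle. Then
`m · log|φ'(0)| ≤ 2 N · log M` (CDT: `m ≤ e · sup_𝕋 log|φ^* p| / log|φ'(0)|`,
`φ^*p = φ^N`). Proof: the dynamic box principle of CDT 2024, Appendix §17
(`holonomyBound_of_lowest_coeff_int`) with the tree's Cauchy estimate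
`norm_coeff_combo_mul_pow_le` for the combination reindexed to monomial degree `< N D`.
[cite: CalegariDimitrovTang2025, Theorem 6 and Theorem 3 (§2, arXiv:2109.09040)]
[cite: CalegariDimitrovTang2024, Appendix §17 eq. (PZ final)] -/
theorem holonomyBound_twisted_sup {N : ℕ} (hN : 0 < N) (f : Fin m → PowerSeries ℚ)
    (hindep : ∀ D : ℕ, LinearIndependent ℚ
      fun ik : Fin m × Fin D => (X : PowerSeries ℚ) ^ (N * (ik.2 : ℕ)) * f ik.1)
    (hint : ∀ (D : ℕ) (c : Fin m × Fin D → ℤ) (n : ℕ),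
      (∀ k < n, coeff k (∑ ik : Fin m × Fin D,
        (c ik : ℚ) • ((X : PowerSeries ℚ) ^ (N * (ik.2 : ℕ)) * f ik.1)) = 0) →
      ∃ z : ℤ, coeff n (∑ ik : Fin m × Fin D,
        (c ik : ℚ) • ((X : PowerSeries ℚ) ^ (N * (ik.2 : ℕ)) * f ik.1)) = z)
    {φ : ℂ → ℂ} {g : Fin m → ℂ → ℂ} {R₀ M G : ℝ} (hR₀ : 1 < R₀)
    (hφ : DifferentiableOn ℂ φ (ball (0 : ℂ) R₀)) (hφ0 : φ 0 = 0)
    (hg : ∀ i, DifferentiableOn ℂ (g i) (ball (0 : ℂ) R₀))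
    (hgerm : ∀ i, ∀ᶠ z in 𝓝 (0 : ℂ),
      HasSum (fun k => ((coeff k (f i) : ℚ) : ℂ) * φ z ^ k) (g i z))
    (hM1 : 1 ≤ M) (hM : ∀ z : ℂ, ‖z‖ = 1 → ‖φ z‖ ≤ M)
    (hGz : ∀ i (z : ℂ), ‖z‖ = 1 → ‖g i z‖ ≤ G) :
    (m : ℝ) * Real.log ‖deriv φ 0‖ ≤ 2 * N * Real.log M := by
  have hMN1 : (1 : ℝ) ≤ M ^ N := one_le_pow₀ hM1
  have key := holonomyBound_of_lowest_coeff_int m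
    (fun D (ik : Fin m × Fin D) => (X : PowerSeries ℚ) ^ (N * (ik.2 : ℕ)) * f ik.1)
    hindep hint (norm_nonneg (deriv φ 0)) hMN1 (G := N * G) ?_
  · rw [Real.log_pow] at key
    linarith
  · intro D T hT c hc n hn
    have hT0 : (0 : ℝ) ≤ T := zero_le_one.trans hT
    simp only [sum_smul_X_pow_mul_eq_combo hN f c] at hn ⊢
    have h := norm_coeff_combo_mul_pow_le (fun i k => coeff k (f i)) _ hR₀ hφ hφ0 hg hgerm
      (fun i j => abs_reindex_le c hT0 hc i j) hM1 hM hGz hn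
    rw [Complex.norm_ratCast] at h
    calc _ ≤ (m : ℝ) * T * ((N * D : ℕ) : ℝ) * M ^ (N * D) * G := h
      _ = m * T * D * (M ^ N) ^ D * (N * G) := by
          push_cast
          rw [pow_mul]
          ring


/-! ### The twisted bound, meromorphic Cauchy estimate and the Nevanlinna characteristic -/

/-- **The Kummer-twisted bound from a quotient representation `φ = v/u`** (the analogue of
`holonomyBound_meromorphic`, CDT 2024 App. §17.3 eq. (PZ final), for the twisted family
`x^{Nk} fᵢ`): with `u, v` holomorphic on `|z| < R₀`, `u(0) = 1`, `v(0) = 0`, a regularising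
factor `h` (`h(0) = 1`) and `Gᵢ = h · (v/u)^* fᵢ` holomorphic there, `|u|, |v| ≤ M` and
`|Gᵢ| ≤ G'` on the unit circle: `m · log|(v/u)'(0)| ≤ 2 N · log M`.
[cite: CalegariDimitrovTang2024, Appendix §17.3 eqs. (sup bound), (PZ final) (p. 130)]
[cite: CalegariDimitrovTang2025, Theorem 6 (§2)] -/
theorem holonomyBound_twisted_meromorphic {N : ℕ} (hN : 0 < N) (f : Fin m → PowerSeries ℚ)
    (hindep : ∀ D : ℕ, LinearIndependent ℚ
      fun ik : Fin m × Fin D => (X : PowerSeries ℚ) ^ (N * (ik.2 : ℕ)) * f ik.1)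
    (hint : ∀ (D : ℕ) (c : Fin m × Fin D → ℤ) (n : ℕ),
      (∀ k < n, coeff k (∑ ik : Fin m × Fin D,
        (c ik : ℚ) • ((X : PowerSeries ℚ) ^ (N * (ik.2 : ℕ)) * f ik.1)) = 0) →
      ∃ z : ℤ, coeff n (∑ ik : Fin m × Fin D,
        (c ik : ℚ) • ((X : PowerSeries ℚ) ^ (N * (ik.2 : ℕ)) * f ik.1)) = z)
    {u v h : ℂ → ℂ} {G g : Fin m → ℂ → ℂ} {R₀ M G' : ℝ} (hR₀ : 1 < R₀)
    (hu : DifferentiableOn ℂ u (ball (0 : ℂ) R₀)) (hv : DifferentiableOn ℂ v (ball (0 : ℂ) R₀))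
    (hu0 : u 0 = 1) (hv0 : v 0 = 0) (hh : ContinuousAt h 0) (hh0 : h 0 = 1)
    (hG : ∀ i, DifferentiableOn ℂ (G i) (ball (0 : ℂ) R₀))
    (hgerm : ∀ i, ∀ᶠ z in 𝓝 (0 : ℂ),
      HasSum (fun k => ((coeff k (f i) : ℚ) : ℂ) * (v z / u z) ^ k) (g i z))
    (hGg : ∀ i, ∀ᶠ z in 𝓝 (0 : ℂ), G i z = h z * g i z)
    (hM1 : 1 ≤ M) (hMu : ∀ z : ℂ, ‖z‖ = 1 → ‖u z‖ ≤ M)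
    (hMv : ∀ z : ℂ, ‖z‖ = 1 → ‖v z‖ ≤ M) (hGz : ∀ i (z : ℂ), ‖z‖ = 1 → ‖G i z‖ ≤ G') :
    (m : ℝ) * Real.log ‖deriv (fun z => v z / u z) 0‖ ≤ 2 * N * Real.log M := by
  have hMN1 : (1 : ℝ) ≤ M ^ N := one_le_pow₀ hM1
  have key := holonomyBound_of_lowest_coeff_int m
    (fun D (ik : Fin m × Fin D) => (X : PowerSeries ℚ) ^ (N * (ik.2 : ℕ)) * f ik.1)
    hindep hint (norm_nonneg (deriv (fun z => v z / u z) 0)) hMN1 (G := N * G') ?_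
  · rw [Real.log_pow] at key
    linarith
  · intro D T hT c hc n hn
    have hT0 : (0 : ℝ) ≤ T := zero_le_one.trans hT
    simp only [sum_smul_X_pow_mul_eq_combo hN f c] at hn ⊢
    have h := norm_coeff_combo_mul_pow_le_mer (fun i k => coeff k (f i)) _ hR₀ hu hv hu0 hv0
      hh hh0 hG hgerm hGg (fun i j => abs_reindex_le c hT0 hc i j) hM1 hMu hMv hGz hn
    rw [Complex.norm_ratCast] at h
    calc _ ≤ (m : ℝ) * T * ((N * D : ℕ) : ℝ) * M ^ (N * D) * G' := h
      _ = m * T * D * (M ^ N) ^ D * (N * G') := by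
          push_cast
          rw [pow_mul]
          ring

/-- **The Kummer-twisted arithmetic holonomy bound** — Calegari–Dimitrov–Tang 2021, Theorem 3
(their arithmetic holonomy bound, arXiv:2109.09040 Theorem 2.0.1 of the published numbering),
for the rational function `p(x) = x^N` and with the constant `e` improved to `2`, in
division-free form:
`m · log|φ'(0)| ≤ 2 · ⨍_𝕋 log⁺|φ^N| = 2N · ⨍_𝕋 log⁺|φ|`.
Data: `f₁,…,f_m ∈ ℚ⟦x⟧` with `(x^{Nk} fᵢ)_{i, k<D}` `ℚ`-linearly independent for all `D`
(i.e. the `fᵢ` are linearly independent over `ℚ(p(x)) = ℚ(x^N)`); Kummer-twisted integrality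
in the abstract form "every integer combination `Σ c(i,k) x^{Nk} fᵢ` has an integral lowest
non-zero coefficient" (which is what (ii) of loc. cit. — `x(t) ∈ t + t²ℚ⟦t⟧`,
`p(x(t)) ∈ ℤ⟦t⟧`, `x^*fᵢ ∈ ℤ⟦t⟧` — gives: the lowest coefficient of `F(x)` equals that of
`F(x(t)) ∈ ℤ⟦t⟧`, CDT's (LLB)); `φ` holomorphic on `|z| < R₀ ⊃ 𝔻̄` with `φ(0) = 0` and the
pullbacks `φ^*fᵢ` meromorphic on `𝔻̄` in the regularised sense of the tree's
`holonomyBound_nevanlinna` (`h`, `Gᵢ = h · φ^*fᵢ` holomorphic, bounded on `𝕋`; CDT (iii) is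
the case `h = 1`). Proof: INDEPENDENT of CDT 2021's own (Siegel lemma in `d → ∞` variables +
Nevanlinna canonical factorisation): the dynamic box principle of CDT 2024, Appendix §17, run
with integrality of lowest coefficients only (`holonomyBound_of_lowest_coeff_int`), the
combination reindexed to monomial degree `< N D`, Nevanlinna's lemma
(`exists_quotient_rep_of_analyticOnNhd`) with `M = exp ⨍_{|z|=R} log⁺|φ|`, and `R → 1⁺`.
This is the algebraization input of CDT's Proposition 15 (with `φ = 16^{-1/N} F_N(r z)`).
[cite: CalegariDimitrovTang2025, Theorem 3 (§2; arXiv:2109.09040) and §3 Proposition 15]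
[cite: CalegariDimitrovTang2024, Appendix §17 eq. (17.1)] -/
theorem holonomyBound_twisted {N : ℕ} (hN : 0 < N) (f : Fin m → PowerSeries ℚ)
    (hindep : ∀ D : ℕ, LinearIndependent ℚ
      fun ik : Fin m × Fin D => (X : PowerSeries ℚ) ^ (N * (ik.2 : ℕ)) * f ik.1)
    (hint : ∀ (D : ℕ) (c : Fin m × Fin D → ℤ) (n : ℕ),
      (∀ k < n, coeff k (∑ ik : Fin m × Fin D,
        (c ik : ℚ) • ((X : PowerSeries ℚ) ^ (N * (ik.2 : ℕ)) * f ik.1)) = 0) →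
      ∃ z : ℤ, coeff n (∑ ik : Fin m × Fin D,
        (c ik : ℚ) • ((X : PowerSeries ℚ) ^ (N * (ik.2 : ℕ)) * f ik.1)) = z)
    {φ h : ℂ → ℂ} {G g : Fin m → ℂ → ℂ} {R₀ G' : ℝ} (hR₀ : 1 < R₀)
    (hφ : DifferentiableOn ℂ φ (ball (0 : ℂ) R₀)) (hφ0 : φ 0 = 0)
    (hh : ContinuousAt h 0) (hh0 : h 0 = 1)
    (hG : ∀ i, DifferentiableOn ℂ (G i) (ball (0 : ℂ) R₀))
    (hgerm : ∀ i, ∀ᶠ z in 𝓝 (0 : ℂ),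
      HasSum (fun k => ((coeff k (f i) : ℚ) : ℂ) * φ z ^ k) (g i z))
    (hGg : ∀ i, ∀ᶠ z in 𝓝 (0 : ℂ), G i z = h z * g i z)
    (hGz : ∀ i (z : ℂ), ‖z‖ = 1 → ‖G i z‖ ≤ G') :
    (m : ℝ) * Real.log ‖deriv φ 0‖ ≤ 2 * N * circleAverage (fun z => log⁺ ‖φ z‖) 0 1 := by
  set k : ℂ → ℝ := fun z => log⁺ ‖φ z‖ with hk
  have hk0 : ∀ R : ℝ, 0 ≤ circleAverage k 0 R := fun R =>
    circleAverage_nonneg_of_nonneg fun z _ => posLog_nonneg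
  have hN0 : (0 : ℝ) ≤ N := Nat.cast_nonneg _
  have hφan : AnalyticOnNhd ℂ φ (ball (0 : ℂ) R₀) := hφ.analyticOnNhd isOpen_ball
  have hball0 : (0 : ℂ) ∈ ball (0 : ℂ) R₀ := mem_ball_self (by linarith)
  -- the degenerate case `φ ≡ 0` near `0`
  by_cases hzero : φ =ᶠ[𝓝 (0 : ℂ)] 0
  · have hd : deriv φ 0 = 0 := by
      rw [hzero.deriv_eq]; exact deriv_const 0 0
    rw [hd, norm_zero, Real.log_zero, mul_zero]
    have := hk0 1
    positivity
  -- orders are finite everywhere on the ball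
  have hord : ∀ z ∈ ball (0 : ℂ) R₀, meromorphicOrderAt φ z ≠ ⊤ := by
    intro z hz htop
    apply hzero
    have h1 : analyticOrderAt φ z = ⊤ := by
      have h := (hφan z hz).meromorphicOrderAt_eq
      rw [htop] at h
      cases h' : analyticOrderAt φ z with
      | top => rfl
      | coe n => rw [h'] at h; simp at h
    rw [analyticOrderAt_eq_top] at h1
    have h2 := hφan.eqOn_zero_of_preconnected_of_eventuallyEq_zero
      (convex_ball (0 : ℂ) R₀).isPreconnected hz h1
    filter_upwards [isOpen_ball.mem_nhds hball0] with x hx using h2 hx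
  -- the bound at every radius `R ∈ (1, R₀)`
  have hR : ∀ R : ℝ, 1 < R → R < R₀ →
      (m : ℝ) * Real.log ‖deriv φ 0‖ ≤ 2 * N * circleAverage k 0 R := by
    intro R h1R hRR₀
    have hRpos : 0 < R := by linarith
    have hsub : closedBall (0 : ℂ) R ⊆ ball (0 : ℂ) R₀ := closedBall_subset_ball hRR₀
    have hφR : AnalyticOnNhd ℂ φ (closedBall (0 : ℂ) R) := hφan.mono hsub
    obtain ⟨u, v, hu, hv, hu0, hune, hvφ, hbd⟩ :=
      exists_quotient_rep_of_analyticOnNhd hRpos hφR fun z hz => hord z (hsub hz)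
    set M : ℝ := Real.exp (circleAverage k 0 R) with hM
    have hM1 : 1 ≤ M := Real.one_le_exp (hk0 R)
    have hballR : ball (0 : ℂ) R ∈ 𝓝 (0 : ℂ) := ball_mem_nhds 0 hRpos
    have hquot : ∀ z ∈ ball (0 : ℂ) R, v z / u z = φ z := by
      intro z hz
      rw [hvφ z hz, mul_div_assoc, div_self (hune z hz), mul_one]
    have hquot_ev : (fun z => v z / u z) =ᶠ[𝓝 (0 : ℂ)] φ := by
      filter_upwards [hballR] with z hz using hquot z hz
    have hderiv : deriv (fun z => v z / u z) 0 = deriv φ 0 := hquot_ev.deriv_eq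
    have hv0 : v 0 = 0 := by rw [hvφ 0 (mem_ball_self hRpos), hφ0, zero_mul]
    have hgerm' : ∀ i, ∀ᶠ z in 𝓝 (0 : ℂ),
        HasSum (fun k => ((coeff k (f i) : ℚ) : ℂ) * (v z / u z) ^ k) (g i z) := by
      intro i
      filter_upwards [hgerm i, hballR] with z hz hzR
      rwa [hquot z hzR]
    have hmain := holonomyBound_twisted_meromorphic hN f hindep hint h1R hu hv hu0 hv0 hh hh0
      (fun i => (hG i).mono (ball_subset_ball hRR₀.le)) hgerm' hGg hM1
      (fun z hz => (hbd z (by simp only [mem_ball, dist_zero_right, hz]; exact h1R)).1)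
      (fun z hz => (hbd z (by simp only [mem_ball, dist_zero_right, hz]; exact h1R)).2) hGz
    rw [hderiv, hM, Real.log_exp] at hmain
    exact hmain
  -- continuity of `R ↦ ⨍ log⁺|φ|` on `[1, R₁]` and the limit `R → 1⁺`
  set R₁ : ℝ := (1 + R₀) / 2 with hR₁
  have h1R₁ : 1 < R₁ := by rw [hR₁]; linarith
  have hR₁R₀ : R₁ < R₀ := by rw [hR₁]; linarith
  have hcont : ContinuousOn (circleAverage k 0) (Icc 1 R₁) := by
    apply ContinuousOn.circleAverage
    · have hkc : ContinuousOn k (ball (0 : ℂ) R₀) :=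
        continuous_posLog.comp_continuousOn hφ.continuousOn.norm
      refine hkc.mono fun z hz => ?_
      simp only [sub_zero, mem_setOf_eq, Set.mem_Icc] at hz
      simp only [mem_ball, dist_zero_right]
      linarith [hz.2]
    · intro r hr; exact zero_le_one.trans hr.1
  have htend : Tendsto (circleAverage k 0) (𝓝[Ioo 1 R₁] 1) (𝓝 (circleAverage k 0 1)) :=
    ((hcont 1 ⟨le_rfl, h1R₁.le⟩).mono Ioo_subset_Icc_self).tendsto
  haveI : (𝓝[Ioo 1 R₁] 1).NeBot := left_nhdsWithin_Ioo_neBot h1R₁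
  have hev : ∀ᶠ R in 𝓝[Ioo 1 R₁] 1,
      (m : ℝ) * Real.log ‖deriv φ 0‖ ≤ 2 * N * circleAverage k 0 R := by
    filter_upwards [self_mem_nhdsWithin] with R hR' using hR R hR'.1 (hR'.2.trans hR₁R₀)
  exact ge_of_tendsto (htend.const_mul (2 * (N : ℝ))) hev

/-! ### Kummer-twisted integrality: the lowest coefficient of `F(x)` is that of `F(x(t))` -/

/-- For `x(t) ∈ t + t²R⟦t⟧` (constant term `0`, linear term `1`): `xᵈ = tᵈ + O(t^{d+1})`, i.e.
`coeff e (x^d) = 0` for `e < d` and `coeff d (x^d) = 1`. [folklore] -/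
theorem coeff_pow_of_constantCoeff_eq_zero {R : Type*} [CommRing R] {x : PowerSeries R}
    (h0 : constantCoeff x = 0) (h1 : coeff 1 x = 1) (d : ℕ) :
    (∀ e < d, coeff e (x ^ d) = 0) ∧ coeff d (x ^ d) = 1 := by
  obtain ⟨y, rfl⟩ : X ∣ x := PowerSeries.X_dvd_iff.mpr h0
  have hy : constantCoeff y = 1 := by
    rw [← h1, ← coeff_zero_eq_constantCoeff_apply]
    simp [coeff_succ_X_mul]
  rw [mul_pow]
  refine ⟨fun e he => ?_, ?_⟩
  · rw [coeff_X_pow_mul', if_neg (not_le.mpr he)]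
  · have := coeff_X_pow_mul (y ^ d) d 0
    rw [zero_add] at this
    rw [this, coeff_zero_eq_constantCoeff_apply, map_pow, hy, one_pow]

/-- **(LLB), formal part**: substituting `x(t) ∈ t + t²ℚ⟦t⟧` does not change the lowest
non-zero coefficient. If `F ∈ ℚ⟦X⟧` has `coeff k F = 0` for `k < n`, then `F(x(t))` has
`coeff k = 0` for `k < n` and `coeff n (F(x(t))) = coeff n F` ("since `x(t) ∈ t + t²ℚ⟦t⟧`, the
term `c tⁿ` is a lowest order monomial in `F(x(t))`").
[cite: CalegariDimitrovTang2025, §2.2 (proof of Theorem 6, Liouville lower bound (LLB))] -/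
theorem coeff_subst_of_forall_lt {R : Type*} [CommRing R] {x : PowerSeries R}
    (h0 : constantCoeff x = 0) (h1 : coeff 1 x = 1) (F : PowerSeries R) {n : ℕ}
    (hF : ∀ k < n, coeff k F = 0) :
    (∀ k < n, coeff k (F.subst x) = 0) ∧ coeff n (F.subst x) = coeff n F := by
  have hx : HasSubst x := HasSubst.of_constantCoeff_zero' h0
  have key : ∀ e ≤ n, coeff e (F.subst x) = coeff e F * coeff e (x ^ e) := by
    intro e he
    rw [coeff_subst' hx]
    rw [finsum_eq_single _ e]
    · rfl
    · intro d hd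
      rcases lt_or_gt_of_ne hd with hlt | hgt
      · -- `d < e ≤ n`: `coeff d F = 0`
        rw [hF d (lt_of_lt_of_le hlt he), zero_smul]
      · -- `d > e`: `coeff e (x^d) = 0`
        rw [(coeff_pow_of_constantCoeff_eq_zero h0 h1 d).1 e hgt, smul_zero]
  refine ⟨fun k hk => ?_, ?_⟩
  · rw [key k hk.le, hF k hk, zero_mul]
  · rw [key n le_rfl, (coeff_pow_of_constantCoeff_eq_zero h0 h1 n).2, mul_one]

/-- Coefficients of products and sums of power series with coefficients in a subring stay in
the subring. [folklore] -/
theorem coeff_mul_mem_subring {R : Type*} [CommRing R] (S : Subring R) {φ ψ : PowerSeries R}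
    (hφ : ∀ n, coeff n φ ∈ S) (hψ : ∀ n, coeff n ψ ∈ S) (n : ℕ) : coeff n (φ * ψ) ∈ S := by
  rw [coeff_mul]
  exact sum_mem fun p _ => mul_mem (hφ _) (hψ _)

/-- Powers likewise. [folklore] -/
theorem coeff_pow_mem_subring {R : Type*} [CommRing R] (S : Subring R) {φ : PowerSeries R}
    (hφ : ∀ n, coeff n φ ∈ S) (k n : ℕ) : coeff n (φ ^ k) ∈ S := by
  induction k generalizing n with
  | zero =>
    rw [pow_zero, coeff_one]
    split_ifs
    · exact one_mem S
    · exact zero_mem S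
  | succ k ih =>
    rw [pow_succ]
    exact coeff_mul_mem_subring S ih hφ n

/-- **Kummer-twisted integrality, as used in CDT 2021 Theorem 3 (ii) ⇒ the abstract hypothesis
`hint` of `holonomyBound_twisted`.** Let `x(t) ∈ t + t²ℚ⟦t⟧` with `x(t)ᴺ ∈ ℤ⟦t⟧`
("`p(x(t)) ∈ ℤ⟦t⟧`", `p = xᴺ`) and `fᵢ(x(t)) ∈ ℤ⟦t⟧` for all `i` ("`x^* fᵢ ∈ ℤ⟦t⟧`"). Then
every integer combination `F = Σ c(i,k) x^{Nk} fᵢ` has an integral lowest non-zero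
coefficient: `F(x(t)) = Σ c(i,k) (x(t)ᴺ)ᵏ fᵢ(x(t)) ∈ ℤ⟦t⟧` and its lowest coefficient is that
of `F`. [cite: CalegariDimitrovTang2025, Theorem 3 (ii) and §2.2 (LLB)] -/
theorem lowest_coeff_int_of_subst {N : ℕ} (f : Fin m → PowerSeries ℚ) {x : PowerSeries ℚ}
    (h0 : constantCoeff x = 0) (h1 : coeff 1 x = 1)
    (hxN : ∀ n, ∃ z : ℤ, coeff n (x ^ N) = z)
    (hfx : ∀ i n, ∃ z : ℤ, coeff n ((f i).subst x) = z)
    (D : ℕ) (c : Fin m × Fin D → ℤ) (n : ℕ)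
    (hn : ∀ k < n, coeff k (∑ ik : Fin m × Fin D,
      (c ik : ℚ) • ((X : PowerSeries ℚ) ^ (N * (ik.2 : ℕ)) * f ik.1)) = 0) :
    ∃ z : ℤ, coeff n (∑ ik : Fin m × Fin D,
      (c ik : ℚ) • ((X : PowerSeries ℚ) ^ (N * (ik.2 : ℕ)) * f ik.1)) = z := by
  have hx : HasSubst x := HasSubst.of_constantCoeff_zero' h0
  set F : PowerSeries ℚ := ∑ ik : Fin m × Fin D,
    (c ik : ℚ) • ((X : PowerSeries ℚ) ^ (N * (ik.2 : ℕ)) * f ik.1) with hFdef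
  -- `F(x(t)) = Σ c • (x^N)^k · fᵢ(x(t))`
  have hsub : F.subst x = ∑ ik : Fin m × Fin D,
      (c ik : ℚ) • ((x ^ N) ^ (ik.2 : ℕ) * (f ik.1).subst x) := by
    rw [hFdef, ← coe_substAlgHom hx, map_sum]
    refine Finset.sum_congr rfl fun ik _ => ?_
    rw [map_smul, map_mul, map_pow, coe_substAlgHom hx, subst_X hx, pow_mul]
  -- its coefficients are integers
  let S : Subring ℚ := (Int.castRingHom ℚ).range
  have hmem : ∀ q : ℚ, (∃ z : ℤ, q = z) ↔ q ∈ S := fun q =>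
    ⟨fun ⟨z, hz⟩ => ⟨z, by rw [hz, eq_intCast]⟩, fun ⟨z, hz⟩ => ⟨z, by rw [← hz, eq_intCast]⟩⟩
  have hint : ∀ e, coeff e (F.subst x) ∈ S := by
    intro e
    rw [hsub, map_sum]
    refine sum_mem fun ik _ => ?_
    rw [map_smul, smul_eq_mul]
    refine mul_mem ⟨c ik, by rw [eq_intCast]⟩ ?_
    exact coeff_mul_mem_subring S
      (coeff_pow_mem_subring S (fun n => (hmem _).mp (hxN n)) _)
      (fun n => (hmem _).mp (hfx ik.1 n)) e
  -- and its lowest coefficient is that of `F`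
  have hlow := (coeff_subst_of_forall_lt h0 h1 F hn).2
  rw [← hlow]
  exact (hmem _).mpr (hint n)

/-- **Calegari–Dimitrov–Tang 2021, Theorem 3, for `p(x) = xᴺ` (constant `2`), with the
Kummer-twisted integrality in its printed form (ii)**: `x(t) ∈ t + t²ℚ⟦t⟧` with
`p(x(t)) = x(t)ᴺ ∈ ℤ⟦t⟧` and `x^*fᵢ = fᵢ(x(t)) ∈ ℤ⟦t⟧`; `f₁,…,f_m` linearly independent over
`ℚ(p(x)) = ℚ(xᴺ)` (as `ℚ`-independence of all `x^{Nk} fᵢ`, `k < D`); `φ` holomorphic on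
`|z| < R₀ ⊃ 𝔻̄`, `φ(0) = 0`, pullbacks regularised-meromorphic (`h`, `Gᵢ = h·φ^*fᵢ`; (iii) of
loc. cit. is `h = 1`). Then `m · log|φ'(0)| ≤ 2N · ⨍_𝕋 log⁺|φ| = 2 ⨍_𝕋 log⁺|p ∘ φ|`.
[cite: CalegariDimitrovTang2025, Theorem 3 (§2; arXiv:2109.09040), used in §3 Proposition 15]
[cite: CalegariDimitrovTang2024, Appendix §17] -/
theorem holonomyBound_twisted_of_subst {N : ℕ} (hN : 0 < N) (f : Fin m → PowerSeries ℚ)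
    (hindep : ∀ D : ℕ, LinearIndependent ℚ
      fun ik : Fin m × Fin D => (X : PowerSeries ℚ) ^ (N * (ik.2 : ℕ)) * f ik.1)
    {x : PowerSeries ℚ} (hx0 : constantCoeff x = 0) (hx1 : coeff 1 x = 1)
    (hxN : ∀ n, ∃ z : ℤ, coeff n (x ^ N) = z)
    (hfx : ∀ i n, ∃ z : ℤ, coeff n ((f i).subst x) = z)
    {φ h : ℂ → ℂ} {G g : Fin m → ℂ → ℂ} {R₀ G' : ℝ} (hR₀ : 1 < R₀)
    (hφ : DifferentiableOn ℂ φ (ball (0 : ℂ) R₀)) (hφ0 : φ 0 = 0)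
    (hh : ContinuousAt h 0) (hh0 : h 0 = 1)
    (hG : ∀ i, DifferentiableOn ℂ (G i) (ball (0 : ℂ) R₀))
    (hgerm : ∀ i, ∀ᶠ z in 𝓝 (0 : ℂ),
      HasSum (fun k => ((coeff k (f i) : ℚ) : ℂ) * φ z ^ k) (g i z))
    (hGg : ∀ i, ∀ᶠ z in 𝓝 (0 : ℂ), G i z = h z * g i z)
    (hGz : ∀ i (z : ℂ), ‖z‖ = 1 → ‖G i z‖ ≤ G') :
    (m : ℝ) * Real.log ‖deriv φ 0‖ ≤ 2 * N * circleAverage (fun z => log⁺ ‖φ z‖) 0 1 :=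
  holonomyBound_twisted hN f hindep (lowest_coeff_int_of_subst f hx0 hx1 hxN hfx) hR₀ hφ hφ0 hh
    hh0 hG hgerm hGg hGz

/-! ### Division form, and the arithmetic of CDT Proposition 15 -/

/-- **CDT 2021 Theorem 3 (`p = xᴺ`, constant `2`), quotient form**: under the hypotheses of
`holonomyBound_twisted_of_subst` and `log|φ'(0)| > 0`,
`m ≤ 2N · ⨍_𝕋 log⁺|φ| / log|φ'(0)| = 2 · ⨍_𝕋 log⁺|p ∘ φ| / log|φ'(0)|` (loc. cit. displays the
bound with `e` in place of `2`). [cite: CalegariDimitrovTang2025, Theorem 3 (§2), display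
(dimensionbound)/(abstracted bound)] -/
theorem holonomyBound_twisted_div {N : ℕ} (hN : 0 < N) (f : Fin m → PowerSeries ℚ)
    (hindep : ∀ D : ℕ, LinearIndependent ℚ
      fun ik : Fin m × Fin D => (X : PowerSeries ℚ) ^ (N * (ik.2 : ℕ)) * f ik.1)
    {x : PowerSeries ℚ} (hx0 : constantCoeff x = 0) (hx1 : coeff 1 x = 1)
    (hxN : ∀ n, ∃ z : ℤ, coeff n (x ^ N) = z)
    (hfx : ∀ i n, ∃ z : ℤ, coeff n ((f i).subst x) = z)
    {φ h : ℂ → ℂ} {G g : Fin m → ℂ → ℂ} {R₀ G' : ℝ} (hR₀ : 1 < R₀)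
    (hφ : DifferentiableOn ℂ φ (ball (0 : ℂ) R₀)) (hφ0 : φ 0 = 0)
    (hh : ContinuousAt h 0) (hh0 : h 0 = 1)
    (hG : ∀ i, DifferentiableOn ℂ (G i) (ball (0 : ℂ) R₀))
    (hgerm : ∀ i, ∀ᶠ z in 𝓝 (0 : ℂ),
      HasSum (fun k => ((coeff k (f i) : ℚ) : ℂ) * φ z ^ k) (g i z))
    (hGg : ∀ i, ∀ᶠ z in 𝓝 (0 : ℂ), G i z = h z * g i z)
    (hGz : ∀ i (z : ℂ), ‖z‖ = 1 → ‖G i z‖ ≤ G')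
    (hpos : 0 < Real.log ‖deriv φ 0‖) :
    (m : ℝ) ≤ 2 * N * circleAverage (fun z => log⁺ ‖φ z‖) 0 1 / Real.log ‖deriv φ 0‖ := by
  rw [le_div_iff₀ hpos]
  exact holonomyBound_twisted_of_subst hN f hindep hx0 hx1 hxN hfx hR₀ hφ hφ0 hh hh0 hG hgerm
    hGg hGz

/-- **The arithmetic of CDT Proposition 15.** If, at level `N`, the uniformising data satisfy
`log|φ'(0)| ≥ c/N³` (from the conformal radius `|F_N'(0)| ≥ 16^{1/N}(1 + A/N³)` and the
dilation `r = 1 − A/(2N³)`, loc. cit. display (lower via unif)) and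
`⨍_𝕋 log⁺|φ| ≤ C₁ log N / N` (the mean growth bound (mean), Theorem 52), then every
`ℚ(xᴺ)`-independent Kummer-integral family with regularised-meromorphic pullbacks has
`m ≤ (2 C₁/c) · N³ log N` — the dimension bound `dim R_{2N} ≤ C N³ log N` of Proposition 15,
here with the explicit constant `C = 2C₁/c` coming from the constant `2` of
`holonomyBound_twisted`. (The passage from modular forms of level `2N` to such families — the
algebraic modular curve finite étale over `Y(2)` and its Fuchsian ODE — and the two analytic
inputs themselves are not formalised here.)
[cite: CalegariDimitrovTang2025, Proposition 15 (§3) and its proof] -/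
theorem card_le_of_radius_of_meanGrowth {N : ℕ} (hN : 0 < N) (f : Fin m → PowerSeries ℚ)
    (hindep : ∀ D : ℕ, LinearIndependent ℚ
      fun ik : Fin m × Fin D => (X : PowerSeries ℚ) ^ (N * (ik.2 : ℕ)) * f ik.1)
    {x : PowerSeries ℚ} (hx0 : constantCoeff x = 0) (hx1 : coeff 1 x = 1)
    (hxN : ∀ n, ∃ z : ℤ, coeff n (x ^ N) = z)
    (hfx : ∀ i n, ∃ z : ℤ, coeff n ((f i).subst x) = z)
    {φ h : ℂ → ℂ} {G g : Fin m → ℂ → ℂ} {R₀ G' : ℝ} (hR₀ : 1 < R₀)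
    (hφ : DifferentiableOn ℂ φ (ball (0 : ℂ) R₀)) (hφ0 : φ 0 = 0)
    (hh : ContinuousAt h 0) (hh0 : h 0 = 1)
    (hG : ∀ i, DifferentiableOn ℂ (G i) (ball (0 : ℂ) R₀))
    (hgerm : ∀ i, ∀ᶠ z in 𝓝 (0 : ℂ),
      HasSum (fun k => ((coeff k (f i) : ℚ) : ℂ) * φ z ^ k) (g i z))
    (hGg : ∀ i, ∀ᶠ z in 𝓝 (0 : ℂ), G i z = h z * g i z)
    (hGz : ∀ i (z : ℂ), ‖z‖ = 1 → ‖G i z‖ ≤ G')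
    {c C₁ : ℝ} (hc : 0 < c) (hradius : c / (N : ℝ) ^ 3 ≤ Real.log ‖deriv φ 0‖)
    (hmean : circleAverage (fun z => log⁺ ‖φ z‖) 0 1 ≤ C₁ * Real.log N / N) :
    (m : ℝ) ≤ 2 * C₁ / c * (N : ℝ) ^ 3 * Real.log N := by
  have hNr : (0 : ℝ) < N := by exact_mod_cast hN
  have hN3 : (0 : ℝ) < (N : ℝ) ^ 3 := by positivity
  have hmain := holonomyBound_twisted_of_subst hN f hindep hx0 hx1 hxN hfx hR₀ hφ hφ0 hh hh0
    hG hgerm hGg hGz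
  have hm0 : (0 : ℝ) ≤ m := Nat.cast_nonneg _
  -- `m · c/N³ ≤ m log|φ'(0)| ≤ 2N · C₁ log N / N = 2 C₁ log N`
  have h1 : (m : ℝ) * (c / (N : ℝ) ^ 3) ≤ 2 * C₁ * Real.log N := by
    calc (m : ℝ) * (c / (N : ℝ) ^ 3) ≤ m * Real.log ‖deriv φ 0‖ :=
          mul_le_mul_of_nonneg_left hradius hm0
      _ ≤ 2 * N * circleAverage (fun z => log⁺ ‖φ z‖) 0 1 := hmain
      _ ≤ 2 * N * (C₁ * Real.log N / N) := by gcongr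
      _ = 2 * C₁ * Real.log N := by field_simp
  rw [mul_div_assoc'] at h1
  rw [div_le_iff₀ hN3] at h1
  calc (m : ℝ) = m * c / c := by field_simp
    _ ≤ 2 * C₁ * Real.log N * (N : ℝ) ^ 3 / c := by gcongr
    _ = 2 * C₁ / c * (N : ℝ) ^ 3 * Real.log N := by ring

/-! ### `ℚ(xᴺ)`-linear independence in the format of CDT Theorem 3 -/

/-- **`ℚ[xᴺ]`-independence ⇒ `ℚ`-independence of the twisted generating families.** If
`f₁,…,f_m ∈ ℚ⟦X⟧` admit no non-trivial relation `Σ Qᵢ(Xᴺ) fᵢ = 0` with polynomials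
`Qᵢ ∈ ℚ[Y]` (linear independence over `ℚ[xᴺ]`, equivalently over the field `ℚ(xᴺ) = ℚ(p(x))`
after clearing denominators — the hypothesis of Calegari–Dimitrov–Tang 2021, Theorem 3), then
for every `D` the family `(X^{Nk} fᵢ)_{i, k<D}` is `ℚ`-linearly independent (the hypothesis
`hindep` of `holonomyBound_twisted`): a `ℚ`-relation with coefficients `c(i,k)` is the
polynomial relation with `Qᵢ = Σ_k c(i,k) Yᵏ`.
[cite: CalegariDimitrovTang2025, Theorem 3 (§2), "`ℚ(p(x))`-linearly independent"] -/
theorem linearIndependent_X_pow_mul_of_forall_aeval {N : ℕ} (f : Fin m → PowerSeries ℚ)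
    (hind : ∀ Q : Fin m → Polynomial ℚ,
      (∑ i, Polynomial.aeval ((X : PowerSeries ℚ) ^ N) (Q i) * f i = 0) → ∀ i, Q i = 0)
    (D : ℕ) :
    LinearIndependent ℚ
      fun ik : Fin m × Fin D => (X : PowerSeries ℚ) ^ (N * (ik.2 : ℕ)) * f ik.1 := by
  classical
  rw [Fintype.linearIndependent_iff]
  intro c hc ik
  -- the polynomials `Qᵢ = Σ_k c(i,k) Yᵏ`
  let Q : Fin m → Polynomial ℚ := fun i => ∑ k : Fin D, Polynomial.monomial (k : ℕ) (c (i, k))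
  have hQ : ∀ i, Polynomial.aeval ((X : PowerSeries ℚ) ^ N) (Q i) =
      ∑ k : Fin D, c (i, k) • (X : PowerSeries ℚ) ^ (N * (k : ℕ)) := by
    intro i
    simp only [Q, map_sum, Polynomial.aeval_monomial, ← pow_mul, Algebra.smul_def]
  -- the `ℚ`-relation is the polynomial relation `Σ Qᵢ(Xᴺ) fᵢ = 0`
  have hrel : ∑ i, Polynomial.aeval ((X : PowerSeries ℚ) ^ N) (Q i) * f i = 0 := by
    simp only [hQ, Finset.sum_mul, smul_mul_assoc]
    rw [← hc, Fintype.sum_prod_type]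
  have hQ0 := hind Q hrel ik.1
  -- read off the coefficient of `Y^k`
  have hcoeff : (Q ik.1).coeff (ik.2 : ℕ) = c ik := by
    simp only [Q, Polynomial.finsetSum_coeff, Polynomial.coeff_monomial]
    rw [Finset.sum_eq_single ik.2]
    · simp
    · intro k _ hk
      rw [if_neg]
      exact fun h => hk (Fin.ext h)
    · intro h
      exact absurd (Finset.mem_univ _) h
  rw [← hcoeff, hQ0, Polynomial.coeff_zero]

end HolonomyBound

end Literature.NumberTheory.Transcendental

end
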